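import Mathlib
import Summits.QuantumFields.YangMills.Theorems.FemtoTransferGapAxisPermutation
import Summits.QuantumFields.YangMills.Theorems.FemtoTransferGapSlabFlowLiftAxisPermutation
import HarnessLib

/-!
# Crux `CovariantCurrentDoor.CurrentNormFloor` ⟨stmt-QuantumFields-23380⟩, line `birth` (planner ym-idea-4 g17): the registered stub
# `stub_directionSymmetry` — CLOSED (axis-permutation symmetry of the vacuum)

`DirectionSymmetryP`: in every `l2`-normalised physical vacuum `Ω` (`K_βΩ = λ₀Ω`) the site-averaged torelon deviations of the two spatial
directions `0` and `1` have the same mean, `⟨F₀Ω, Ω⟩ = ⟨F₁Ω, Ω⟩`.  Proof: the axis transposition `π = (0 1)` acts on fine fields by the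
measure-preserving `configPerm π` (tree `measurePreserving_configPerm'`), carries the flowed Polyakov lift of the direction-`0` deviation to
that of direction `1` (`flowLift_configPerm`: the Wilson flow and the Polyakov triple are `S₃`-equivariant — tree
`wilsonFlow_configPerm`, `polyakovSite_configPerm`), and leaves every raw vacuum invariant POINTWISE (tree ★ `rawVacuum_comp_configPerm`,
Jentzsch simplicity).  HONEST FRAMING: fixed-lattice symmetry bookkeeping; the crux `CurrentNormFloor`, K2a and the YM mass gap are NOT proved.
No `sorry`, no new axiom; the `abbrev` is a registered-stub copy (verbatim), not a citable fact.  References: [cite: Luscher1983, §2];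
[cite: ReedSimonIV1978, Thm. XIII.43].
-/

set_option autoImplicit false

noncomputable section

open MeasureTheory
open scoped BigOperators
open Literature.MathematicalPhysics.QuantumFieldTheory (GaugeConfig Site Edge configPerm sitePerm configPerm_apply sitePerm_apply)

namespace Summit.QuantumFields.YangMills.Theorems.CovariantCurrentDoor

open Summit.QuantumFields.YangMills.Theorems.FemtoTransferGap

variable {L : ℕ} [NeZero L]

/-- The flowed Polyakov lift at base point `x` of the permuted field is the lift at `σ⁻¹x` of the permuted one-site function. [cite: Luscher1983, §2] -/
theorem flowLiftAt_configPerm (π : Equiv.Perm (Fin 3)) (x : Site 3 L) (t : ℝ) (f : GaugeConfig 3 1 SU2 → ℝ) (U : GaugeConfig 3 L SU2) :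
    flowLiftAt x t f (configPerm π U) = flowLiftAt (sitePerm π.symm x) t (fun V => f (configPerm π V)) U := by
  simp only [flowLiftAt, Summit.Ventures.LatticeQCDFlow.Scoring.wilsonFlow_configPerm, polyakovSite_configPerm]

/-- **`(flowLift t f) ∘ configPerm π = flowLift t (f ∘ configPerm π)`**: the site average absorbs the relabelling `x ↦ σ⁻¹x`. [cite: Luscher1983, §2] -/
theorem flowLift_configPerm (π : Equiv.Perm (Fin 3)) (t : ℝ) (f : GaugeConfig 3 1 SU2 → ℝ) (U : GaugeConfig 3 L SU2) :
    flowLift t f (configPerm π U) = flowLift t (fun V => f (configPerm π V)) U := by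
  simp only [flowLift, flowLiftAt_configPerm]
  congr 1
  exact Equiv.sum_comp (sitePerm π.symm) (fun y => flowLiftAt y t (fun V => f (configPerm π V)) U)

/-- On the one-point torus the transposition `(0 1)` carries the direction-`0` torelon deviation to the direction-`1` one. [folklore] -/
theorem torelonDev_zero_configPerm_swap (u : GaugeConfig 3 1 SU2) :
    4 - ((su2Rep ((configPerm (Equiv.swap (0 : Fin 3) 1) u) ((0 : Site 3 1), (0 : Fin 3)))).trace.re) ^ 2 =
      4 - ((su2Rep (u ((0 : Site 3 1), (1 : Fin 3)))).trace.re) ^ 2 := by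
  have hsite : sitePerm (Equiv.swap (0 : Fin 3) 1).symm (0 : Site 3 1) = 0 := Subsingleton.elim _ _
  have hdir : (Equiv.swap (0 : Fin 3) 1).symm (0 : Fin 3) = 1 := by
    rw [Equiv.symm_swap, Equiv.swap_apply_left]
  rw [configPerm_apply, hsite, hdir]

/-- The registered stub statement `DirectionSymmetryP` of line `birth` of crux ⟨stmt-QuantumFields-23380⟩ (verbatim copy of the skeleton's
`BirthCNF.DirectionSymmetryP`; a registered-stub copy, not a citable fact). -/
abbrev DirectionSymmetryP : Prop :=
  ∀ β : ℝ, 0 < β → ∀ (L : ℕ) [NeZero L], ∀ Ω : Literature.MathematicalPhysics.QuantumFieldTheory.GaugeConfig 3 L SU2 → ℝ, IsPhys Ω → l2 Ω Ω = 1 → transferApply β Ω = topValue su2Rep L β • Ω → let F0 : Literature.MathematicalPhysics.QuantumFieldTheory.GaugeConfig 3 L SU2 → ℝ := flowLift 0 (fun u : Literature.MathematicalPhysics.QuantumFieldTheory.GaugeConfig 3 1 SU2 => 4 - ((su2Rep (u ((0 : Literature.MathematicalPhysics.QuantumFieldTheory.Site 3 1), (0 : Fin 3)))).trace.re) ^ 2);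 let F1 : Literature.MathematicalPhysics.QuantumFieldTheory.GaugeConfig 3 L SU2 → ℝ := flowLift 0 (fun u : Literature.MathematicalPhysics.QuantumFieldTheory.GaugeConfig 3 1 SU2 => 4 - ((su2Rep (u ((0 : Literature.MathematicalPhysics.QuantumFieldTheory.Site 3 1), (1 : Fin 3)))).trace.re) ^ 2); l2 (fun U => F0 U * Ω U) Ω = l2 (fun U => F1 U * Ω U) Ω

/-- ★★ **`stub_directionSymmetry`** (registered stub of the birth skeleton of crux ⟨stmt-QuantumFields-23380⟩, signature
`DirectionSymmetryP` verbatim): `⟨F₀Ω, Ω⟩ = ⟨F₁Ω, Ω⟩` for every normalised physical vacuum, by the axis transposition `(0 1)`.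
[cite: Luscher1983, §2] [cite: ReedSimonIV1978, Thm. XIII.43] -/
theorem stub_directionSymmetry : DirectionSymmetryP := by
  intro β _hβ L _ Ω hΩ _hn heig
  dsimp only
  set π : Equiv.Perm (Fin 3) := Equiv.swap (0 : Fin 3) 1 with hπ
  have heig' : transferApply β Ω = levelValue su2Rep L β 0 • Ω := by rw [levelValue_zero]; exact heig
  have hΩinv : ∀ U : GaugeConfig 3 L SU2, Ω (configPerm π U) = Ω U := rawVacuum_comp_configPerm β hΩ heig' π
  -- the direction-0 lift of the permuted field is the direction-1 lift
  have hF : ∀ U : GaugeConfig 3 L SU2,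
      flowLift 0 (fun u : GaugeConfig 3 1 SU2 => 4 - ((su2Rep (u ((0 : Site 3 1), (0 : Fin 3)))).trace.re) ^ 2) (configPerm π U) =
        flowLift 0 (fun u : GaugeConfig 3 1 SU2 => 4 - ((su2Rep (u ((0 : Site 3 1), (1 : Fin 3)))).trace.re) ^ 2) U := by
    intro U
    rw [flowLift_configPerm]
    simp only [hπ, torelonDev_zero_configPerm_swap]
  -- change of variables `U ↦ configPerm π U` in the left integral
  unfold l2
  rw [← (measurePreserving_configPerm' π).integral_comp' (f := configPerm π)
    (fun U => flowLift 0 (fun u : GaugeConfig 3 1 SU2 => 4 - ((su2Rep (u ((0 : Site 3 1), (0 : Fin 3)))).trace.re) ^ 2) U * Ω U * Ω U)]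
  refine integral_congr_ae (ae_of_all _ fun U => ?_)
  dsimp only
  rw [hF U, hΩinv U]

end Summit.QuantumFields.YangMills.Theorems.CovariantCurrentDoor

end
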